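import Summits.BirchSwinnertonDyer.BirchSwinnertonDyer.Theorems.SignedLowerHalvesSprungLowerDivisibilityAtThreeRankZeroBranch
import Summits.BirchSwinnertonDyer.Rank1Residual.SecondDescent.NonemptyRecordsThree05
import Summits.BirchSwinnertonDyer.Rank1Residual.SecondDescent.NonemptyRecordsThree07
import Summits.BirchSwinnertonDyer.Rank1Residual.SecondDescent.NonemptyRecordsThree08
import HarnessLib

/-!
# Crux K1 `SprungLowerDivisibilityAtThree` (stmt-BirchSwinnertonDyer-19875), line `chromatic-common-zeros`: the three rank-0 'N'
# DOOR-LESS cells of the chromatic census close per pair through the tree's `BSD(E,3)` records (common-zero TOLERANT road)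
# (`--supports` 19875 as helper; per-pair; closes nothing; K_spor / K1 / leaf X8 / BSD are NOT proved here)

Cell `bsd-ssimc`, width seat `cruxlead-…-19875-w2` (g7). STUB-PLAN-stub_katoFineLowerSporadic §3 rank 4 / card k1 Plan C (critic: «READY,
sorry-free SketchC; for the x8 desk / referee R-list; evidence tier = displayed descent witnesses; not F-CIRC: the BSDp inputs are LANDED
records, not assumptions»): the x8 census cells `210469a1`, `425650k1`, `490100u1` (X8, `r_an = 0`, `ρ̄_{E,3}` onto, `#Ш_an = 81`; door-less
under every zero-SEPARATING lens — Newton polygon in T or Y, ι-trace, Bézout, quotient certificates) carry `BSD(E,3)` in the tree as second-descent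
RECORDS (`bsdp3_b1n1_210469a1`, `bsdp3_b1n1_425650k1`, `bsdp3_b1n_490100u1`, cell `b2b-bsdres`, 2026-08-22; descent witnesses displayed,
Cassels–Tate displayed for the one-witness records), and `K1Branch.sprungSharpFlatLowerDivisibility_of_bsdp` (`…RankZeroBranch`, 2026-08-27)
turns `BSD(E,3)` on an X8 ∧ Surj(3) ∧ `r_an = 0` pair into K1's predicate for EITHER colour WITHOUT looking at any zero of `L♯`, `L♭` —
hence the K_spor content for these pairs (frame `sprungLowerDivisibility_iff_katoFineLower`, p617250). This file is the per-cell
composition, with `ClassX8` / `Surj` DISCHARGED by the kernel certificates `classX8_s…` / `surj3_s…` (`Sha81TargetsKernelCertificatesS0{2,4,5}`).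

CONDITIONAL (displayed named facts, exactly the two source theorems' binders): `h714`, `h716` (Sprung 2012 Thm. 7.14 / 7.16),
`h59` (Sprung 2024 Lemma 5.9 all-`n` value formula), `h3` (period unit), `hL20` (Wuthrich 2014 Lemma 20), `hGZK`, `hmod`,
`hW` (`sha_dvd_analyticSha`), `hCT` (Cassels–Tate, one-witness records); per-cell data: the descent witnesses `c₁, c₂, d…` in `Ш` and
`#Ш_an = q` with `v₃(q) ≤ 4`. Referee note: this road TOLERATES a genuine sporadic common zero (it never separates zeros), so it is
disjoint in kind from doors (R1)–(R19′).

References: [Sprung2012] Thm. 7.14, 7.16, Main Conj. 7.21; [Sprung2024] Lemma 5.9; [Wuthrich2014] Lemma 20, Prop. 21; [Creutz2014]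
(second 3-descent); tree: `…RankZeroBranch` (`K1Branch.sprungSharpFlatLowerDivisibility_of_bsdp`), `SecondDescent/NonemptyRecordsThree0{5,7,8}`.
-/

set_option autoImplicit false
set_option linter.dupNamespace false

noncomputable section

open scoped Classical NumberField MatrixGroups ModularForm
open NumberField IsDedekindDomain WeierstrassCurve CongruenceSubgroup
  Literature.NumberTheory.EllipticCurves Literature.NumberTheory.EllipticCurves.ModularForms
  Literature.NumberTheory.EllipticCurves.Rank1Residual
  Literature.NumberTheory.EllipticCurves.Rank1Residual.Typed
  Literature.NumberTheory.EllipticCurves.Sprung2017 Literature.NumberTheory.EllipticCurves.Sprung2012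
  Literature.NumberTheory.EllipticCurves.Sprung2024
  Literature.NumberTheory.EllipticCurves.ZpExtension
  Literature.NumberTheory.EllipticCurves.Wuthrich2014
  Summit.BirchSwinnertonDyer.Rank1Residual.Supersingular
  Summit.BirchSwinnertonDyer.Rank1Residual.SecondDescent
  Summit.BirchSwinnertonDyer.BirchSwinnertonDyer.Theses.SignedLowerHalves
  Summit.BirchSwinnertonDyer.BirchSwinnertonDyer.Theorems

namespace Summit.BirchSwinnertonDyer.BirchSwinnertonDyer.Theorems.ChromaticCommonZeros

/-- **`490100u1`** (X8 'N' cell, equal edge slopes; `r_an = 0`, Surj(3), `#Ш_an = 81`, `∏c = 3`): K1's predicate for EITHER colour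
from the tree's record `bsdp3_b1n_490100u1` (two NONEMPTY second-descent witnesses, NO Cassels–Tate) through
`K1Branch.sprungSharpFlatLowerDivisibility_of_bsdp`; `ClassX8`/`Surj(3)` by the kernel certificates. No zero of `L♯`/`L♭` is looked at.
[cite: Sprung2012, Thm. 7.14, Thm. 7.16 and Main Conj. 7.21] [cite: Wuthrich2014, Lemma 20, Prop. 21] [cite: Sprung2024, Lemma 5.9] -/
theorem sprungSharpFlatLowerDivisibility_s490100u1_of_bsdpRecord
    (h714 : thm714_sharpFlatSelmerDual_finite_torsion) (h716 : thm716_sharpFlatCharIdeal_divisibility)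
    (h59 : lem59AllN_sharpFlatCharValue_rankZero) (h3 : realPeriodRat_eq_unit_mul_plusPeriod_three)
    (hL20 : Wuthrich2014.lemma20_surjective_threeAdic_of_semistable)
    (hGZK : rank_eq_analyticRank_of_analyticRank_le_one) (hmod : hasEntireLFunction_rat)
    (hW : sha_dvd_analyticSha)
    (W : WeierstrassCurve ℚ) [W.IsElliptic] [W.IsGloballyMinimal]
    (hWm : W = ⟨0, 0, 0, -20410975, -35493084250⟩) (hr : W.analyticRank = 0)
    {c₁ c₂ d₁ d₂ : W.sha} (h1 : 3 • c₁ = 0) (h2 : 3 • c₂ = 0) (hc₁ : c₁ ≠ 0)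
    (hind : c₂ ∉ AddSubgroup.zmultiples c₁) (hd₁ : 3 • d₁ = c₁) (hd₂ : 3 • d₂ = c₂)
    {q : ℚ} (hq : shaAn W = (q : ℂ)) (hv : padicValRat 3 q ≤ 4) (col : Chroma) :
    SprungSharpFlatLowerDivisibility W 3 col := by
  have hB := bsdp3_b1n_490100u1 hW hGZK hmod W hWm hr h1 h2 hc₁ hind hd₁ hd₂ hq hv
  subst hWm
  exact K1Branch.sprungSharpFlatLowerDivisibility_of_bsdp h714 h716 h59 h3 hL20 hGZK hmod _ 3
    classX8_s490100u1 surj3_s490100u1 hr hB col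

/-- **`210469a1`** (X8 'N' cell, slopes `{2}`; `r_an = 0`, Surj(3), `#Ш_an = 81`): K1's predicate for EITHER colour from the ONE-WITNESS
record `bsdp3_b1n1_210469a1` (Cassels–Tate displayed) through `K1Branch.sprungSharpFlatLowerDivisibility_of_bsdp`.
[cite: Sprung2012, Thm. 7.14, Thm. 7.16 and Main Conj. 7.21] [cite: Wuthrich2014, Lemma 20, Prop. 21] [cite: Sprung2024, Lemma 5.9] -/
theorem sprungSharpFlatLowerDivisibility_s210469a1_of_bsdpRecord
    (h714 : thm714_sharpFlatSelmerDual_finite_torsion) (h716 : thm716_sharpFlatCharIdeal_divisibility)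
    (h59 : lem59AllN_sharpFlatCharValue_rankZero) (h3 : realPeriodRat_eq_unit_mul_plusPeriod_three)
    (hL20 : Wuthrich2014.lemma20_surjective_threeAdic_of_semistable)
    (hGZK : rank_eq_analyticRank_of_analyticRank_le_one) (hmod : hasEntireLFunction_rat)
    (hCT : exists_casselsTate_pairing (K := ℚ)) (hW : sha_dvd_analyticSha)
    (W : WeierstrassCurve ℚ) [W.IsElliptic] [W.IsGloballyMinimal]
    (hWm : W = ⟨1, -1, 1, -74548346034381, -247745114809980547440⟩) (hr : W.analyticRank = 0)
    {c₁ c₂ d : W.sha} (h1 : 3 • c₁ = 0) (h2 : 3 • c₂ = 0) (hc₁ : c₁ ≠ 0)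
    (hind : c₂ ∉ AddSubgroup.zmultiples c₁) (hd : 3 • d = c₁)
    {q : ℚ} (hq : shaAn W = (q : ℂ)) (hv : padicValRat 3 q ≤ 4) (col : Chroma) :
    SprungSharpFlatLowerDivisibility W 3 col := by
  have hB := bsdp3_b1n1_210469a1 hCT hW hGZK hmod W hWm hr h1 h2 hc₁ hind hd hq hv
  subst hWm
  exact K1Branch.sprungSharpFlatLowerDivisibility_of_bsdp h714 h716 h59 h3 hL20 hGZK hmod _ 3
    classX8_s210469a1 surj3_s210469a1 hr hB col

/-- **`425650k1`** (X8 'N' cell, slopes `{1, 1/2}`; `r_an = 0`, Surj(3), `#Ш_an = 81`): K1's predicate for EITHER colour from the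
ONE-WITNESS record `bsdp3_b1n1_425650k1` (Cassels–Tate displayed) through `K1Branch.sprungSharpFlatLowerDivisibility_of_bsdp`.
[cite: Sprung2012, Thm. 7.14, Thm. 7.16 and Main Conj. 7.21] [cite: Wuthrich2014, Lemma 20, Prop. 21] [cite: Sprung2024, Lemma 5.9] -/
theorem sprungSharpFlatLowerDivisibility_s425650k1_of_bsdpRecord
    (h714 : thm714_sharpFlatSelmerDual_finite_torsion) (h716 : thm716_sharpFlatCharIdeal_divisibility)
    (h59 : lem59AllN_sharpFlatCharValue_rankZero) (h3 : realPeriodRat_eq_unit_mul_plusPeriod_three)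
    (hL20 : Wuthrich2014.lemma20_surjective_threeAdic_of_semistable)
    (hGZK : rank_eq_analyticRank_of_analyticRank_le_one) (hmod : hasEntireLFunction_rat)
    (hCT : exists_casselsTate_pairing (K := ℚ)) (hW : sha_dvd_analyticSha)
    (W : WeierstrassCurve ℚ) [W.IsElliptic] [W.IsGloballyMinimal]
    (hWm : W = ⟨1, -1, 0, -6870742, -6931171084⟩) (hr : W.analyticRank = 0)
    {c₁ c₂ d : W.sha} (h1 : 3 • c₁ = 0) (h2 : 3 • c₂ = 0) (hc₁ : c₁ ≠ 0)
    (hind : c₂ ∉ AddSubgroup.zmultiples c₁) (hd : 3 • d = c₁)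
    {q : ℚ} (hq : shaAn W = (q : ℂ)) (hv : padicValRat 3 q ≤ 4) (col : Chroma) :
    SprungSharpFlatLowerDivisibility W 3 col := by
  have hB := bsdp3_b1n1_425650k1 hCT hW hGZK hmod W hWm hr h1 h2 hc₁ hind hd hq hv
  subst hWm
  exact K1Branch.sprungSharpFlatLowerDivisibility_of_bsdp h714 h716 h59 h3 hL20 hGZK hmod _ 3
    classX8_s425650k1 surj3_s425650k1 hr hB col

end Summit.BirchSwinnertonDyer.BirchSwinnertonDyer.Theorems.ChromaticCommonZeros

end
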